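import Literature.AlgebraicGeometry.Resolution.WeightedCentreOneRound
import HarnessLib

/-!
# Sectors: the layer equations of all `y_<`-sectors at once (E1 §5.1, §5.3–5.5 stacked)

Engine 1's block step at a block `B` below already-straightened higher blocks works sector by
sector: the face polynomial is expanded along the monomials `y_<^ν` in the higher-block variables
`L` (which the substitution `ψ` fixes), `h_Δ = Σ_ν y_<^ν · m_ν`, the face equation splits as
`m_ν ∘ ψ = m_ν - [ν = 0]·c` (Qν), every sector has its own layer equation (⋆)_ν, and the dichotomy
is over the COMMON kernel `V = ⋂_ν ker (v ↦ Σ_k v_k ∂ₖ F_ν)` of the stacked coefficient matrix.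

This file types the stacking in the cell's polynomial model (all statements derived here):

* `eq_zero_of_sum_mul_monomial_eq_zero` — uniqueness of an expansion `Σ_ν a_ν · X^ν` with
  exponents `ν` in a variable set `L` and coefficients free of `L`;
* `map_monomial_of_fix`, `map_free_of_map_X` — a substitution fixing the variables of `L` fixes the
  `L`-monomials, and one mapping the other variables to `L`-free polynomials preserves
  `L`-freeness;
* `sector_face_equation` — (Qν): `ψ H = H - c` with `H = Σ_{ν ∈ A} m_ν X^ν` gives
  `ψ m_ν = m_ν - [ν = 0] c` for every sector;
* `IsBlockSubstitution.layer_equation_of_fix` — the layer equation for a sector with `c = 0`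
  (no restriction on the layer index);
* `sum_mul_pderiv_sectorSum` / `sum_smul_pderiv_sectorSum` — block derivatives commute with the
  sector tags: `Σ_k S_k ∂ₖ (Σ_ν F_ν X^ν) = Σ_ν (Σ_k S_k ∂ₖ F_ν) X^ν` for `B ∩ L = ∅`;
* `exists_common_kernel_vector` — the stacked `V ≠ 0` exit: if every sector satisfies
  `Σ_k S_k ∂ₖ F_ν = 0` and some shift `S_{k₀} ≠ 0`, one constant vector `v ≠ 0` on `B` kills
  `Σ_k v_k ∂ₖ F_ν` for EVERY sector `ν`;
* `shift_eq_map_sub_of_free` / `exists_straightening_of_free` — the coboundary formula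
  `S_k = ψ(g_k) - g_k` for an arbitrary splitting of the variables (the top form free of a set
  `T` carrying the shifts; generalizes `WeightedCentreBlockShift.shift_eq_map_sub`, the case
  `T = complement of B`), which is what the tagged sum `F̂ = Σ_ν F_ν X^ν` needs;
* `exists_straightening_of_sectors` — the stacked `V = 0` exit: per-sector block-basis
  identities and injectivity of the STACKED constant map `v ↦ (Σ_k v_k ∂ₖ F_ν)_ν` give
  `T`-supported `g_k` with `S_k = ψ(g_k) - g_k` and `ψ (X_k - g_k) = X_k - g_k` on the block.

Fidelity notes.  (i) As in `WeightedCentreOneRound`, the free variables of weight `0` enter E1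
through units of `k[[free]]`; the polynomial model types the case where the relevant layers are
polynomial in them (they are simply part of `T` or of the complement of `B ∪ L`).  (ii) The tags
`L` stand for the higher, already straightened blocks `y_<` (fixed by `ψ`, E1 §5.1); the
induction over the blocks itself (E1 §5.5, last paragraph) is not typed here.

Value: typed bookkeeping in the W(f) model — NOT a resolution theorem, NOT summit progress.

References: [HauserWagner2014] (T) translational moves (arXiv p. 14–15);
[Hironaka1970AdditiveGroups] additive forms and differential operators;
[AbramovichTemkinWlodarczyk2024] §3.4 (p. 1570), §5.2 (pp. 1576–1577).
-/

open MvPolynomial Finsupp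

namespace Literature.AlgebraicGeometry.Resolution.WeightedBlowup

variable {K : Type*} [Field K] {σ : Type*} [DecidableEq σ]

/-! ## §0 Variable bookkeeping (private helpers) -/

omit [DecidableEq σ] in
/-- Variables of a product. [folklore] -/
private theorem allVars_mul (p : σ → Prop) {P Q : MvPolynomial σ K}
    (hP : ∀ d ∈ P.support, ∀ i ∈ d.support, p i) (hQ : ∀ d ∈ Q.support, ∀ i ∈ d.support, p i) :
    ∀ d ∈ (P * Q).support, ∀ i ∈ d.support, p i := by
  classical
  intro d hd i hi
  obtain ⟨d1, hd1, d2, hd2, rfl⟩ := Finset.mem_add.mp (support_mul P Q hd)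
  rcases Finset.mem_union.mp (Finsupp.support_add hi) with h | h
  · exact hP d1 hd1 i h
  · exact hQ d2 hd2 i h

omit [DecidableEq σ] in
/-- Variables of a finite sum. [folklore] -/
private theorem allVars_sum (p : σ → Prop) {ι : Type*} (A : Finset ι) {P : ι → MvPolynomial σ K}
    (hP : ∀ a ∈ A, ∀ d ∈ (P a).support, ∀ i ∈ d.support, p i) :
    ∀ d ∈ (∑ a ∈ A, P a).support, ∀ i ∈ d.support, p i := by
  classical
  intro d hd i hi
  obtain ⟨a, ha, hda⟩ := Finset.mem_biUnion.mp (support_sum hd)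
  exact hP a ha d hda i hi

omit [DecidableEq σ] in
/-- Variables of a scalar multiple. [folklore] -/
private theorem allVars_smul (p : σ → Prop) (c : K) {P : MvPolynomial σ K}
    (hP : ∀ d ∈ P.support, ∀ i ∈ d.support, p i) :
    ∀ d ∈ (c • P).support, ∀ i ∈ d.support, p i :=
  fun d hd i hi => hP d (MvPolynomial.support_smul hd) i hi

omit [DecidableEq σ] in
/-- Variables of a difference. [folklore] -/
private theorem allVars_sub (p : σ → Prop) {P Q : MvPolynomial σ K}
    (hP : ∀ d ∈ P.support, ∀ i ∈ d.support, p i) (hQ : ∀ d ∈ Q.support, ∀ i ∈ d.support, p i) :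
    ∀ d ∈ (P - Q).support, ∀ i ∈ d.support, p i := by
  classical
  intro d hd i hi
  rw [sub_eq_add_neg] at hd
  rcases Finset.mem_union.mp (MvPolynomial.support_add hd) with h | h
  · exact hP d h i hi
  · exact hQ d (by rwa [MvPolynomial.support_neg] at h) i hi

omit [DecidableEq σ] in
/-- Variables of a monomial. [folklore] -/
private theorem allVars_monomial (p : σ → Prop) {ν : σ →₀ ℕ} (hν : ∀ i ∈ ν.support, p i) (c : K) :
    ∀ d ∈ (monomial ν c).support, ∀ i ∈ d.support, p i := by
  intro d hd i hi
  have hd' : d = ν := Finset.mem_singleton.mp (support_monomial_subset hd)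
  subst hd'
  exact hν i hi

/-! ## §1 Uniqueness of expansions along a set of variables -/

omit [DecidableEq σ] in
/-- **Uniqueness of sector expansions.**  If the exponents `ν ∈ R` involve only variables of
`L` and the coefficients `a_ν` involve none, then `Σ_{ν ∈ R} a_ν · X^ν = 0` forces `a_ν = 0` for
every `ν ∈ R` (derived here, from `eq_zero_of_sum_mul_eq_zero`: distinct monomials are linearly
independent). [cite: AbramovichTemkinWlodarczyk2024, §3.4 (p. 1570)] -/
theorem eq_zero_of_sum_mul_monomial_eq_zero (L : Set σ) (R : Finset (σ →₀ ℕ))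
    (hR : ∀ ν ∈ R, ∀ i ∈ ν.support, i ∈ L) {a : (σ →₀ ℕ) → MvPolynomial σ K}
    (ha : ∀ ν ∈ R, ∀ d ∈ (a ν).support, ∀ i ∈ d.support, i ∉ L)
    (h0 : ∑ ν ∈ R, a ν * monomial ν 1 = 0) : ∀ ν ∈ R, a ν = 0 := by
  classical
  refine eq_zero_of_sum_mul_eq_zero R {i | i ∉ L} ha ?_ ?_ h0
  · intro ν hν d hd i hi hiL
    exact hiL (allVars_monomial (· ∈ L) (hR ν hν) 1 d hd i hi)
  · intro v hv ν hν
    have h := congr_arg (coeff ν) hv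
    rw [coeff_sum, coeff_zero] at h
    have h1 : ∀ μ ∈ R, coeff ν (v μ • monomial μ (1 : K)) = if μ = ν then v μ else 0 := by
      intro μ _
      rw [coeff_smul, coeff_monomial, smul_eq_mul]
      split_ifs <;> simp
    rw [Finset.sum_congr rfl h1, Finset.sum_ite_eq' R ν, if_pos hν] at h
    exact h

/-! ## §2 Substitutions fixing a set of variables -/

omit [DecidableEq σ] in
/-- A substitution fixing the variables occurring in `ν` fixes the monomial `c · X^ν`
(derived here). [cite: HauserWagner2014, (T) translational move (arXiv p. 14)] -/
theorem map_monomial_of_fix (ψ : MvPolynomial σ K →ₐ[K] MvPolynomial σ K) {ν : σ →₀ ℕ}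
    (hfix : ∀ i ∈ ν.support, ψ (X i) = X i) (c : K) : ψ (monomial ν c) = monomial ν c := by
  rw [monomial_eq, map_mul, algHom_C, MvPolynomial.algebraMap_eq, Finsupp.prod, map_prod]
  refine congr_arg _ (Finset.prod_congr rfl fun i hi => ?_)
  rw [map_pow, hfix i hi]

/-- A substitution mapping every variable outside `L` to an `L`-free polynomial maps `L`-free
polynomials to `L`-free polynomials (derived here: on them it agrees with its flat part `ψ♭_L`,
which is graded for the `L`-degree). [cite: AbramovichTemkinWlodarczyk2024, §3.4 (p. 1570)] -/
theorem map_free_of_map_X (L : Finset σ) (ψ : MvPolynomial σ K →ₐ[K] MvPolynomial σ K)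
    (hψL : ∀ j ∉ L, ∀ d ∈ (ψ (X j)).support, ∀ i ∈ d.support, i ∉ L)
    {P : MvPolynomial σ K} (hP : ∀ d ∈ P.support, ∀ i ∈ d.support, i ∉ L) :
    ∀ d ∈ (ψ P).support, ∀ i ∈ d.support, i ∉ L := by
  rw [← blockFlat_eq_map_of_blockFree ψ hP]
  exact blockFree_of_isWeightedHomogeneous_zero
    (isWeightedHomogeneous_blockFlat
      (fun i hi => isWeightedHomogeneous_zero_of_blockFree (hψL i hi))
      (isWeightedHomogeneous_zero_of_blockFree hP))

/-! ## §3 The face equation splits by sectors (E1 (Qν)) -/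

/-- **Sector face equations (Qν).**  Let `ψ` fix the variables of `L` and map the other
variables to `L`-free polynomials.  If `H = Σ_{ν ∈ A} m_ν · X^ν` with exponents `ν` in `L`
(`0 ∈ A`) and `L`-free `m_ν`, then the face equation `ψ H = H - c` splits:
`ψ m_ν = m_ν - [ν = 0] c` for every `ν ∈ A` (derived here).
[cite: HauserWagner2014, (T) translational move (arXiv p. 14–15)] -/
theorem sector_face_equation (L : Finset σ) (ψ : MvPolynomial σ K →ₐ[K] MvPolynomial σ K)
    (hfix : ∀ i ∈ L, ψ (X i) = X i)
    (hψL : ∀ j ∉ L, ∀ d ∈ (ψ (X j)).support, ∀ i ∈ d.support, i ∉ L)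
    (A : Finset (σ →₀ ℕ)) (hA : ∀ ν ∈ A, ∀ i ∈ ν.support, i ∈ L) (h0A : (0 : σ →₀ ℕ) ∈ A)
    (m : (σ →₀ ℕ) → MvPolynomial σ K)
    (hm : ∀ ν ∈ A, ∀ d ∈ (m ν).support, ∀ i ∈ d.support, i ∉ L)
    {H : MvPolynomial σ K} (hH : H = ∑ ν ∈ A, m ν * monomial ν 1) {c : K}
    (hQ : ψ H = H - C c) :
    ∀ ν ∈ A, ψ (m ν) = m ν - if ν = 0 then C c else 0 := by
  classical
  have e1 : ψ H = ∑ ν ∈ A, ψ (m ν) * monomial ν 1 := by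
    rw [hH, map_sum]
    refine Finset.sum_congr rfl fun ν hν => ?_
    rw [map_mul, map_monomial_of_fix ψ (fun i hi => hfix i (hA ν hν i hi))]
  have e2 : ∑ ν ∈ A, (if ν = 0 then C c else (0 : MvPolynomial σ K)) * monomial ν 1 = C c := by
    rw [Finset.sum_eq_single_of_mem 0 h0A (fun ν _ hν => by rw [if_neg hν, zero_mul]),
      if_pos rfl, ← C_apply, ← C_mul, mul_one]
  have key : ∑ ν ∈ A, (ψ (m ν) - m ν + if ν = 0 then C c else 0) * monomial ν 1 = 0 := by
    have e3 : ∑ ν ∈ A, (ψ (m ν) - m ν + if ν = 0 then C c else 0) * monomial ν 1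
        = ∑ ν ∈ A, ψ (m ν) * monomial ν 1 - ∑ ν ∈ A, m ν * monomial ν 1
            + ∑ ν ∈ A, (if ν = 0 then C c else (0 : MvPolynomial σ K)) * monomial ν 1 := by
      rw [← Finset.sum_sub_distrib, ← Finset.sum_add_distrib]
      refine Finset.sum_congr rfl fun ν _ => ?_
      rw [add_mul, sub_mul]
    rw [e3, ← e1, ← hH, e2, hQ]
    ring
  have ha : ∀ ν ∈ A, ∀ d ∈ (ψ (m ν) - m ν + if ν = 0 then C c else 0).support,
      ∀ i ∈ d.support, i ∉ L := by
    intro ν hν d hd i hi hiL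
    rcases Finset.mem_union.mp (MvPolynomial.support_add hd) with h | h
    · exact allVars_sub (· ∉ L) (map_free_of_map_X L ψ hψL (hm ν hν)) (hm ν hν) d h i hi hiL
    · split_ifs at h with h0
      · rw [C_apply] at h
        have hd0 : d = 0 := Finset.mem_singleton.mp (support_monomial_subset h)
        subst hd0
        simp at hi
      · simp at h
  intro ν hν
  have h := eq_zero_of_sum_mul_monomial_eq_zero (↑L : Set σ) A
    (fun μ hμ i hi => Finset.mem_coe.mpr (hA μ hμ i hi))
    (fun μ hμ d hd i hi hiL => ha μ hμ d hd i hi (Finset.mem_coe.mp hiL)) key ν hν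
  linear_combination h

/-- **Layer equation of a sector with `c = 0`.**  For a block substitution and `ψ H = H` with
`H` of block degree `≤ m + 1`:  `Σ_k S_k ψ♭ ∂ₖ [H]ₘ₊₁ = [H]ₘ - ψ♭ [H]ₘ` — for every `m`, also
`m = 0` (derived here; the sectors `ν ≠ 0` of (Qν)).
[cite: HauserWagner2014, (T) translational move (arXiv p. 14–15)] -/
theorem IsBlockSubstitution.layer_equation_of_fix {B : Finset σ}
    {ψ : MvPolynomial σ K →ₐ[K] MvPolynomial σ K} {S : σ → MvPolynomial σ K}
    (hψ : IsBlockSubstitution B ψ S) {H : MvPolynomial σ K} {m : ℕ}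
    (hH : ∀ d ∈ H.support, weight (blockWeight B) d ≤ m + 1) (hQ : ψ H = H) :
    blockDifferential B ψ S (weightedHomogeneousComponent (blockWeight B) (m + 1) H) =
      weightedHomogeneousComponent (blockWeight B) m H -
        blockFlat B ψ (weightedHomogeneousComponent (blockWeight B) m H) := by
  have h1 := hψ.layer_eq hH
  rw [hQ] at h1
  rw [eq_sub_iff_add_eq, add_comm]
  exact h1.symm

/-! ## §4 Block derivatives commute with the sector tags -/

omit [DecidableEq σ] in
/-- `∂ₖ (X^ν · P) = X^ν · ∂ₖ P` if `X_k` does not occur in `X^ν` (derived here).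
[cite: Hironaka1970AdditiveGroups, differential operators on forms] -/
theorem pderiv_mul_monomial_of_notMem {ν : σ →₀ ℕ} {k : σ} (hk : k ∉ ν.support)
    (P : MvPolynomial σ K) :
    pderiv k (P * monomial ν (1 : K)) = pderiv k P * monomial ν 1 := by
  have h0 : pderiv k (monomial ν (1 : K)) = 0 := by
    rw [pderiv_monomial, Finsupp.notMem_support_iff.mp hk, Nat.cast_zero, mul_zero, map_zero]
  rw [pderiv_mul, h0, mul_zero, add_zero]

omit [DecidableEq σ] in
/-- **Stacking.**  For a block `B` disjoint from the tag variables `L` and sector exponents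
`ν ∈ A` in `L`:  `Σ_{k ∈ B} S_k ∂ₖ (Σ_ν F_ν X^ν) = Σ_ν (Σ_{k ∈ B} S_k ∂ₖ F_ν) X^ν` (derived here).
[cite: Hironaka1970AdditiveGroups, differential operators on forms] -/
theorem sum_mul_pderiv_sectorSum {L B : Finset σ} (hLB : ∀ k ∈ B, k ∉ L)
    (A : Finset (σ →₀ ℕ)) (hA : ∀ ν ∈ A, ∀ i ∈ ν.support, i ∈ L)
    (F : (σ →₀ ℕ) → MvPolynomial σ K) (S : σ → MvPolynomial σ K) :
    ∑ k ∈ B, S k * pderiv k (∑ ν ∈ A, F ν * monomial ν 1)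
      = ∑ ν ∈ A, (∑ k ∈ B, S k * pderiv k (F ν)) * monomial ν 1 := by
  have hd : ∀ k ∈ B, ∀ ν ∈ A,
      pderiv k (F ν * monomial ν (1 : K)) = pderiv k (F ν) * monomial ν 1 := by
    intro k hk ν hν
    exact pderiv_mul_monomial_of_notMem (fun h => hLB k hk (hA ν hν k h)) (F ν)
  calc ∑ k ∈ B, S k * pderiv k (∑ ν ∈ A, F ν * monomial ν 1)
      = ∑ k ∈ B, ∑ ν ∈ A, S k * pderiv k (F ν) * monomial ν 1 := by
        refine Finset.sum_congr rfl fun k hk => ?_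
        rw [map_sum, Finset.mul_sum]
        refine Finset.sum_congr rfl fun ν hν => ?_
        rw [hd k hk ν hν, mul_assoc]
    _ = ∑ ν ∈ A, ∑ k ∈ B, S k * pderiv k (F ν) * monomial ν 1 := Finset.sum_comm
    _ = ∑ ν ∈ A, (∑ k ∈ B, S k * pderiv k (F ν)) * monomial ν 1 := by
        refine Finset.sum_congr rfl fun ν _ => ?_
        rw [Finset.sum_mul]

omit [DecidableEq σ] in
/-- **Stacking, constant vectors.**  `Σ_{k ∈ B} v_k • ∂ₖ (Σ_ν F_ν X^ν) = Σ_ν (Σ_{k ∈ B} v_k • ∂ₖ F_ν) X^ν`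
(derived here). [cite: Hironaka1970AdditiveGroups, differential operators on forms] -/
theorem sum_smul_pderiv_sectorSum {L B : Finset σ} (hLB : ∀ k ∈ B, k ∉ L)
    (A : Finset (σ →₀ ℕ)) (hA : ∀ ν ∈ A, ∀ i ∈ ν.support, i ∈ L)
    (F : (σ →₀ ℕ) → MvPolynomial σ K) (v : σ → K) :
    (∑ k ∈ B, v k • pderiv k (∑ ν ∈ A, F ν * monomial ν 1))
      = ∑ ν ∈ A, (∑ k ∈ B, v k • pderiv k (F ν)) * monomial ν 1 := by
  have h := sum_mul_pderiv_sectorSum hLB A hA F (fun k => C (v k))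
  simp only [← smul_eq_C_mul] at h
  exact h

/-! ## §5 The stacked `V ≠ 0` exit -/

omit [DecidableEq σ] in
/-- **A common kernel vector for all sectors.**  Let the block `B` be disjoint from the tag
variables `L`, the sector exponents `ν ∈ A` lie in `L`, the top forms `F_ν` involve neither `L`
nor the shift variables `T` (`T ∩ L = ∅`), and the shifts `S_k` (`k ∈ B`) involve only `T`.  If
every sector satisfies `Σ_k S_k ∂ₖ F_ν = 0` and some `S_{k₀} ≠ 0`, then ONE constant vector
`v ≠ 0` on `B` satisfies `Σ_k v_k ∂ₖ F_ν = 0` for every `ν ∈ A` — `V = ⋂_ν ker M_ν(0) ≠ 0`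
(derived here: kernel extraction for the tagged sum `F̂ = Σ_ν F_ν X^ν`, then uniqueness of the
sector expansion). [cite: HauserWagner2014, (T) translational move (arXiv p. 14–15)]
[cite: Hironaka1970AdditiveGroups, additive forms and differential operators] -/
theorem exists_common_kernel_vector {L B : Finset σ} (hLB : ∀ k ∈ B, k ∉ L) (T : Set σ)
    (hLT : ∀ i ∈ L, i ∉ T)
    (A : Finset (σ →₀ ℕ)) (hA : ∀ ν ∈ A, ∀ i ∈ ν.support, i ∈ L)
    (F : (σ →₀ ℕ) → MvPolynomial σ K)
    (hFT : ∀ ν ∈ A, ∀ d ∈ (F ν).support, ∀ i ∈ d.support, i ∉ T)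
    (hFL : ∀ ν ∈ A, ∀ d ∈ (F ν).support, ∀ i ∈ d.support, i ∉ L)
    {S : σ → MvPolynomial σ K} (hS : ∀ k ∈ B, ∀ d ∈ (S k).support, ∀ i ∈ d.support, i ∈ T)
    (h0 : ∀ ν ∈ A, ∑ k ∈ B, S k * pderiv k (F ν) = 0)
    {k₀ : σ} (hk₀ : k₀ ∈ B) (hne : S k₀ ≠ 0) :
    ∃ v : σ → K, (∀ ν ∈ A, (∑ k ∈ B, v k • pderiv k (F ν)) = 0) ∧ ∃ k ∈ B, v k ≠ 0 := by
  classical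
  have hFhat : ∀ d ∈ (∑ ν ∈ A, F ν * monomial ν 1).support, ∀ i ∈ d.support, i ∉ T :=
    allVars_sum (· ∉ T) A fun ν hν =>
      allVars_mul (· ∉ T) (hFT ν hν) (allVars_monomial (· ∉ T) (fun i hi => hLT i (hA ν hν i hi)) 1)
  have h0hat : ∑ k ∈ B, S k * pderiv k (∑ ν ∈ A, F ν * monomial ν 1) = 0 := by
    rw [sum_mul_pderiv_sectorSum hLB A hA F S]
    exact Finset.sum_eq_zero fun ν hν => by rw [h0 ν hν, zero_mul]
  obtain ⟨v, hv, hk⟩ := exists_kernel_vector_of_shift_ne_zero B T hFhat hS h0hat hk₀ hne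
  refine ⟨v, fun ν hν => ?_, hk⟩
  have hsum : ∑ μ ∈ A, (∑ k ∈ B, v k • pderiv k (F μ)) * monomial μ 1 = 0 := by
    rw [← sum_smul_pderiv_sectorSum hLB A hA F v]
    exact hv
  refine eq_zero_of_sum_mul_monomial_eq_zero (↑L : Set σ) A
    (fun μ hμ i hi => Finset.mem_coe.mpr (hA μ hμ i hi)) (fun μ hμ => ?_) hsum ν hν
  intro d hd i hi hiL
  exact allVars_sum (· ∉ L) B
    (fun k _ => allVars_smul (· ∉ L) (v k)
      (support_pderiv_subset_of_support (↑L : Set σ)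
        (fun d hd i hi h => hFL μ hμ d hd i hi (Finset.mem_coe.mp h)) k))
    d hd i hi hiL

/-! ## §6 Straightening for an arbitrary splitting of the variables -/

omit [DecidableEq σ] in
/-- A combination of `T`-supported polynomials is `T`-supported. [folklore] -/
private theorem allVars_sum_smul (p : σ → Prop) (R : Finset (σ →₀ ℕ)) (c : (σ →₀ ℕ) → K)
    (Q : (σ →₀ ℕ) → MvPolynomial σ K) (hQ : ∀ β ∈ R, ∀ d ∈ (Q β).support, ∀ i ∈ d.support, p i) :
    ∀ d ∈ (∑ β ∈ R, c β • Q β).support, ∀ i ∈ d.support, p i :=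
  allVars_sum p R fun β hβ => allVars_smul p (c β) (hQ β hβ)

omit [DecidableEq σ] in
/-- **The shift is a coboundary, general splitting.**  Let `T` be a set of variables, `F` a
polynomial free of `T`, `L` a left inverse of `v ↦ Σ_{j ∈ B} v_j ∂ⱼ F` on constant vectors, `R` a
finite set of `T`-free exponents, `n_β`, `ψ (n_β)` (`β ∈ R`) and the shifts `S_k` (`k ∈ B`)
supported in `T`.  If `Σ_{k ∈ B} S_k ∂ₖ F = Σ_{β ∈ R} (n_β - ψ n_β) · X^β`, then
`S_k = ψ (g_k) - g_k` with `g_k := -Σ_β L(X^β)_k • n_β` for every `k ∈ B` (derived here;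
`WeightedCentreBlockShift.shift_eq_map_sub` is the case `T = σ ∖ B`).
[cite: HauserWagner2014, (T) translational move (arXiv p. 14–15)] -/
theorem shift_eq_map_sub_of_free (B : Finset σ) (T : Set σ) {F : MvPolynomial σ K}
    (hF : ∀ d ∈ F.support, ∀ i ∈ d.support, i ∉ T)
    (L : MvPolynomial σ K →ₗ[K] (σ → K))
    (hL : ∀ v : σ → K, ∀ k ∈ B, L (∑ j ∈ B, v j • pderiv j F) k = v k)
    (R : Finset (σ →₀ ℕ)) (hR : ∀ β ∈ R, ∀ i ∈ β.support, i ∉ T)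
    (n : (σ →₀ ℕ) → MvPolynomial σ K)
    (hn : ∀ β ∈ R, ∀ d ∈ (n β).support, ∀ i ∈ d.support, i ∈ T)
    (ψ : MvPolynomial σ K →ₐ[K] MvPolynomial σ K)
    (hψn : ∀ β ∈ R, ∀ d ∈ (ψ (n β)).support, ∀ i ∈ d.support, i ∈ T)
    {S : σ → MvPolynomial σ K}
    (hS : ∀ k ∈ B, ∀ d ∈ (S k).support, ∀ i ∈ d.support, i ∈ T)
    (hstar : ∑ k ∈ B, S k * pderiv k F = ∑ β ∈ R, (n β - ψ (n β)) * monomial β 1)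
    {k : σ} (hk : k ∈ B) :
    S k = ψ (-∑ β ∈ R, L (monomial β 1) k • n β) - (-∑ β ∈ R, L (monomial β 1) k • n β) := by
  classical
  have hrhs : ψ (-∑ β ∈ R, L (monomial β 1) k • n β) - (-∑ β ∈ R, L (monomial β 1) k • n β)
      = ∑ β ∈ R, L (monomial β 1) k • (n β - ψ (n β)) := by
    rw [map_neg, map_sum, sub_neg_eq_add, neg_add_eq_sub, ← Finset.sum_sub_distrib]
    refine Finset.sum_congr rfl fun β _ => ?_
    rw [map_smul, smul_sub]
  rw [hrhs]
  have hdF : ∀ j, ∀ d ∈ (pderiv j F).support, ∀ i ∈ d.support, i ∉ T :=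
    fun j => support_pderiv_subset_of_support T hF j
  have hδ : ∀ β ∈ R, ∀ d ∈ (n β - ψ (n β)).support, ∀ i ∈ d.support, i ∈ T :=
    fun β hβ => allVars_sub (· ∈ T) (hn β hβ) (hψn β hβ)
  have hmon : ∀ β ∈ R, ∀ d ∈ (monomial β (1 : K)).support, ∀ i ∈ d.support, i ∉ T :=
    fun β hβ => allVars_monomial (· ∉ T) (hR β hβ) 1
  ext d
  by_cases hd : ∃ i ∈ d.support, i ∉ T
  · -- a monomial with a variable outside `T`: both sides vanish
    obtain ⟨i, hi, hiT⟩ := hd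
    have h1 : coeff d (S k) = 0 := by
      by_contra h
      exact hiT (hS k hk d (MvPolynomial.mem_support_iff.mpr h) i hi)
    have h2 : coeff d (∑ β ∈ R, L (monomial β 1) k • (n β - ψ (n β))) = 0 := by
      by_contra h
      exact hiT (allVars_sum_smul (· ∈ T) R _ _ hδ d (MvPolynomial.mem_support_iff.mpr h) i hi)
    rw [h1, h2]
  · -- a `T`-monomial `e := d`: compare the `e`-slices
    have he : ∀ i ∈ d.support, i ∈ T := fun i hi => by
      by_contra h
      exact hd ⟨i, hi, h⟩
    set c : σ → K := fun j => coeff d (S j) with hc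
    have hslice : (∑ j ∈ B, c j • pderiv j F)
        = ∑ β ∈ R, coeff d (n β - ψ (n β)) • monomial β 1 := by
      ext f
      rw [coeff_sum, coeff_sum]
      simp only [coeff_smul, smul_eq_mul]
      by_cases hf : ∃ i ∈ f.support, i ∈ T
      · -- `f` touches `T`: every term vanishes on both sides
        obtain ⟨i, hi, hiT⟩ := hf
        have hl : ∀ j ∈ B, c j * coeff f (pderiv j F) = 0 := by
          intro j _
          have : coeff f (pderiv j F) = 0 := by
            by_contra h
            exact hdF j f (MvPolynomial.mem_support_iff.mpr h) i hi hiT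
          rw [this, mul_zero]
        have hr : ∀ β ∈ R, coeff d (n β - ψ (n β)) * coeff f (monomial β 1) = 0 := by
          intro β hβ
          have : coeff f (monomial β (1 : K)) = 0 := by
            by_contra h
            exact hmon β hβ f (MvPolynomial.mem_support_iff.mpr h) i hi hiT
          rw [this, mul_zero]
        rw [Finset.sum_congr rfl hl, Finset.sum_congr rfl hr, Finset.sum_const_zero,
          Finset.sum_const_zero]
      · have hf' : ∀ i ∈ f.support, i ∉ T := fun i hi h => hf ⟨i, hi, h⟩
        have hl : ∀ j ∈ B, c j * coeff f (pderiv j F) = coeff (d + f) (S j * pderiv j F) :=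
          fun j hj => (coeff_add_mul_of_support T (hS j hj) (hdF j) he hf').symm
        have hr : ∀ β ∈ R, coeff d (n β - ψ (n β)) * coeff f (monomial β 1)
            = coeff (d + f) ((n β - ψ (n β)) * monomial β 1) :=
          fun β hβ => (coeff_add_mul_of_support T (hδ β hβ) (hmon β hβ) he hf').symm
        rw [Finset.sum_congr rfl hl, Finset.sum_congr rfl hr, ← coeff_sum, ← coeff_sum, hstar]
    have happly := hL c k hk
    rw [hslice, map_sum] at happly
    simp only [map_smul, Finset.sum_apply, Pi.smul_apply, smul_eq_mul] at happly
    rw [show coeff d (S k) = c k from rfl, ← happly, coeff_sum]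
    refine Finset.sum_congr rfl fun β _ => ?_
    rw [coeff_smul, smul_eq_mul, mul_comm]

omit [DecidableEq σ] in
/-- **Straightening, general splitting.**  Under the hypotheses of `shift_eq_map_sub_of_free`,
`ψ (X_k) = X_k + S_k` on the block and injectivity of `v ↦ Σ_k v_k ∂ₖ F` on constant vectors,
there are `T`-supported `g_k` with `S_k = ψ (g_k) - g_k` and `ψ (X_k - g_k) = X_k - g_k` for
every `k ∈ B` (derived here). [cite: HauserWagner2014, (T) translational move (arXiv p. 14–15)]
[cite: AbramovichTemkinWlodarczyk2024, §5.2 (pp. 1576–1577)] -/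
theorem exists_straightening_of_free (B : Finset σ) (T : Set σ) {F : MvPolynomial σ K}
    (hF : ∀ d ∈ F.support, ∀ i ∈ d.support, i ∉ T)
    (hinj : ∀ v : σ → K, (∑ k ∈ B, v k • pderiv k F) = 0 → ∀ k ∈ B, v k = 0)
    (R : Finset (σ →₀ ℕ)) (hR : ∀ β ∈ R, ∀ i ∈ β.support, i ∉ T)
    (n : (σ →₀ ℕ) → MvPolynomial σ K)
    (hn : ∀ β ∈ R, ∀ d ∈ (n β).support, ∀ i ∈ d.support, i ∈ T)
    (ψ : MvPolynomial σ K →ₐ[K] MvPolynomial σ K)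
    (hψn : ∀ β ∈ R, ∀ d ∈ (ψ (n β)).support, ∀ i ∈ d.support, i ∈ T)
    {S : σ → MvPolynomial σ K}
    (hS : ∀ k ∈ B, ∀ d ∈ (S k).support, ∀ i ∈ d.support, i ∈ T)
    (hX : ∀ k ∈ B, ψ (X k) = X k + S k)
    (hstar : ∑ k ∈ B, S k * pderiv k F = ∑ β ∈ R, (n β - ψ (n β)) * monomial β 1) :
    ∃ g : σ → MvPolynomial σ K,
      (∀ k ∈ B, ∀ d ∈ (g k).support, ∀ i ∈ d.support, i ∈ T) ∧
      (∀ k ∈ B, S k = ψ (g k) - g k) ∧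
      (∀ k ∈ B, ψ (X k - g k) = X k - g k) := by
  classical
  obtain ⟨L, hL⟩ := exists_blockLeftInverse B (fun j => pderiv j F) hinj
  refine ⟨fun k => -∑ β ∈ R, L (monomial β 1) k • n β, fun k _ => ?_, fun k hk => ?_,
    fun k hk => ?_⟩
  · intro d hd i hi
    rw [support_neg] at hd
    exact allVars_sum_smul (· ∈ T) R _ n hn d hd i hi
  · exact shift_eq_map_sub_of_free B T hF L hL R hR n hn ψ hψn hS hstar hk
  · exact map_sub_eq_self_of_shift ψ (hX k hk)
      (shift_eq_map_sub_of_free B T hF L hL R hR n hn ψ hψn hS hstar hk)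

/-! ## §7 The stacked `V = 0` exit -/

/-- **Straightening from the per-sector identities.**  Block `B` disjoint from the tags `L`;
sector exponents `ν ∈ A` in `L`; top forms `F_ν` free of `L` and of the shift variables `T`
(`T ∩ L = ∅`, `T ∩ B = ∅`); per sector a block-basis identity
`Σ_{k ∈ B} S_k ∂ₖ F_ν = Σ_{β ∈ R_ν} (n_{ν,β} - ψ n_{ν,β}) X^β` with `β` free of `T` and of `L`
and `n_{ν,β}`, `ψ n_{ν,β}`, `S_k` supported in `T`; and injectivity of the STACKED constant map
`v ↦ (Σ_k v_k ∂ₖ F_ν)_ν` on `K^B`.  Then there are `T`-supported `g_k` with `S_k = ψ(g_k) - g_k`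
and `ψ (X_k - g_k) = X_k - g_k` for every `k ∈ B` (derived here: straightening for the tagged
sum `F̂ = Σ_ν F_ν X^ν` with exponents `ν + β`).
[cite: HauserWagner2014, (T) translational move (arXiv p. 14–15)]
[cite: AbramovichTemkinWlodarczyk2024, §5.2 (pp. 1576–1577)] -/
theorem exists_straightening_of_sectors {L B : Finset σ} (hLB : ∀ k ∈ B, k ∉ L) (T : Set σ)
    (hLT : ∀ i ∈ L, i ∉ T)
    (A : Finset (σ →₀ ℕ)) (hA : ∀ ν ∈ A, ∀ i ∈ ν.support, i ∈ L)
    (F : (σ →₀ ℕ) → MvPolynomial σ K)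
    (hFT : ∀ ν ∈ A, ∀ d ∈ (F ν).support, ∀ i ∈ d.support, i ∉ T)
    (hFL : ∀ ν ∈ A, ∀ d ∈ (F ν).support, ∀ i ∈ d.support, i ∉ L)
    (hinj : ∀ v : σ → K, (∀ ν ∈ A, (∑ k ∈ B, v k • pderiv k (F ν)) = 0) → ∀ k ∈ B, v k = 0)
    (R : (σ →₀ ℕ) → Finset (σ →₀ ℕ))
    (hRT : ∀ ν ∈ A, ∀ β ∈ R ν, ∀ i ∈ β.support, i ∉ T)
    (hRL : ∀ ν ∈ A, ∀ β ∈ R ν, ∀ i ∈ β.support, i ∉ L)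
    (n : (σ →₀ ℕ) → (σ →₀ ℕ) → MvPolynomial σ K)
    (hn : ∀ ν ∈ A, ∀ β ∈ R ν, ∀ d ∈ (n ν β).support, ∀ i ∈ d.support, i ∈ T)
    (ψ : MvPolynomial σ K →ₐ[K] MvPolynomial σ K)
    (hψn : ∀ ν ∈ A, ∀ β ∈ R ν, ∀ d ∈ (ψ (n ν β)).support, ∀ i ∈ d.support, i ∈ T)
    {S : σ → MvPolynomial σ K}
    (hS : ∀ k ∈ B, ∀ d ∈ (S k).support, ∀ i ∈ d.support, i ∈ T)
    (hX : ∀ k ∈ B, ψ (X k) = X k + S k)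
    (hstar : ∀ ν ∈ A, ∑ k ∈ B, S k * pderiv k (F ν)
      = ∑ β ∈ R ν, (n ν β - ψ (n ν β)) * monomial β 1) :
    ∃ g : σ → MvPolynomial σ K,
      (∀ k ∈ B, ∀ d ∈ (g k).support, ∀ i ∈ d.support, i ∈ T) ∧
      (∀ k ∈ B, S k = ψ (g k) - g k) ∧
      (∀ k ∈ B, ψ (X k - g k) = X k - g k) := by
  classical
  -- the tagged top form and its injectivity
  have hFhat : ∀ d ∈ (∑ ν ∈ A, F ν * monomial ν 1).support, ∀ i ∈ d.support, i ∉ T :=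
    allVars_sum (· ∉ T) A fun ν hν =>
      allVars_mul (· ∉ T) (hFT ν hν) (allVars_monomial (· ∉ T) (fun i hi => hLT i (hA ν hν i hi)) 1)
  have hinjhat : ∀ v : σ → K,
      (∑ k ∈ B, v k • pderiv k (∑ ν ∈ A, F ν * monomial ν 1)) = 0 → ∀ k ∈ B, v k = 0 := by
    intro v hv
    refine hinj v fun ν hν => ?_
    have hsum : ∑ μ ∈ A, (∑ k ∈ B, v k • pderiv k (F μ)) * monomial μ 1 = 0 := by
      rw [← sum_smul_pderiv_sectorSum hLB A hA F v]
      exact hv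
    refine eq_zero_of_sum_mul_monomial_eq_zero (↑L : Set σ) A
      (fun μ hμ i hi => Finset.mem_coe.mpr (hA μ hμ i hi)) (fun μ hμ => ?_) hsum ν hν
    intro d hd i hi hiL
    exact allVars_sum (· ∉ L) B
      (fun k _ => allVars_smul (· ∉ L) (v k)
        (support_pderiv_subset_of_support (↑L : Set σ)
          (fun d hd i hi h => hFL μ hμ d hd i hi (Finset.mem_coe.mp h)) k))
      d hd i hi hiL
  -- the tagged exponents `ν + β` and coefficients
  let Rhat : Finset (σ →₀ ℕ) := A.biUnion fun ν => (R ν).image fun β => ν + β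
  -- recover `ν` and `β` from `ν + β`: the `L`-part and the rest
  have hsplit : ∀ ν ∈ A, ∀ β ∈ R ν, ∀ ν' ∈ A, ∀ β' ∈ R ν', ν + β = ν' + β' → ν = ν' ∧ β = β' := by
    intro ν hν β hβ ν' hν' β' hβ' h
    have hL1 : ∀ μ ∈ A, ∀ γ ∈ R μ, (μ + γ).filter (· ∈ L) = μ := by
      intro μ hμ γ hγ
      ext i
      rw [Finsupp.filter_apply]
      split_ifs with hi
      · rw [Finsupp.add_apply, Finsupp.notMem_support_iff.mp (fun h => hRL μ hμ γ hγ i h hi),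
          add_zero]
      · exact (Finsupp.notMem_support_iff.mp (fun h => hi (hA μ hμ i h))).symm
    have h1 : ν = ν' := by rw [← hL1 ν hν β hβ, ← hL1 ν' hν' β' hβ', h]
    refine ⟨h1, ?_⟩
    subst h1
    exact add_left_cancel h
  -- the coefficient attached to a tagged exponent
  let nhat : (σ →₀ ℕ) → MvPolynomial σ K := fun γ =>
    ∑ ν ∈ A, ∑ β ∈ R ν, if ν + β = γ then n ν β else 0
  have hnhat : ∀ ν ∈ A, ∀ β ∈ R ν, nhat (ν + β) = n ν β := by
    intro ν hν β hβ
    show (∑ ν' ∈ A, ∑ β' ∈ R ν', if ν' + β' = ν + β then n ν' β' else 0) = n ν β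
    rw [Finset.sum_eq_single_of_mem ν hν, Finset.sum_eq_single_of_mem β hβ, if_pos rfl]
    · intro β' hβ' hne
      rw [if_neg]
      intro h
      exact hne (hsplit ν hν β' hβ' ν hν β hβ h).2
    · intro ν' hν' hne
      refine Finset.sum_eq_zero fun β' hβ' => ?_
      rw [if_neg]
      intro h
      exact hne (hsplit ν' hν' β' hβ' ν hν β hβ h).1
  have hRhatT : ∀ γ ∈ Rhat, ∀ i ∈ γ.support, i ∉ T := by
    intro γ hγ i hi
    obtain ⟨ν, hν, hγ'⟩ := Finset.mem_biUnion.mp hγ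
    obtain ⟨β, hβ, rfl⟩ := Finset.mem_image.mp hγ'
    rcases Finset.mem_union.mp (Finsupp.support_add hi) with h | h
    · exact hLT i (hA ν hν i h)
    · exact hRT ν hν β hβ i h
  have hnhatT : ∀ γ ∈ Rhat, ∀ d ∈ (nhat γ).support, ∀ i ∈ d.support, i ∈ T := by
    intro γ hγ
    obtain ⟨ν, hν, hγ'⟩ := Finset.mem_biUnion.mp hγ
    obtain ⟨β, hβ, rfl⟩ := Finset.mem_image.mp hγ'
    rw [hnhat ν hν β hβ]
    exact hn ν hν β hβ
  have hψnhatT : ∀ γ ∈ Rhat, ∀ d ∈ (ψ (nhat γ)).support, ∀ i ∈ d.support, i ∈ T := by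
    intro γ hγ
    obtain ⟨ν, hν, hγ'⟩ := Finset.mem_biUnion.mp hγ
    obtain ⟨β, hβ, rfl⟩ := Finset.mem_image.mp hγ'
    rw [hnhat ν hν β hβ]
    exact hψn ν hν β hβ
  -- the tagged block-basis identity
  have hstarhat : ∑ k ∈ B, S k * pderiv k (∑ ν ∈ A, F ν * monomial ν 1)
      = ∑ γ ∈ Rhat, (nhat γ - ψ (nhat γ)) * monomial γ 1 := by
    rw [sum_mul_pderiv_sectorSum hLB A hA F S]
    have e1 : ∀ ν ∈ A, (∑ k ∈ B, S k * pderiv k (F ν)) * monomial ν 1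
        = ∑ β ∈ R ν, (n ν β - ψ (n ν β)) * monomial (ν + β) 1 := by
      intro ν hν
      rw [hstar ν hν, Finset.sum_mul]
      refine Finset.sum_congr rfl fun β _ => ?_
      rw [mul_assoc, monomial_mul, mul_one, add_comm]
    rw [Finset.sum_congr rfl e1]
    symm
    rw [Finset.sum_biUnion]
    · refine Finset.sum_congr rfl fun ν hν => ?_
      rw [Finset.sum_image]
      · refine Finset.sum_congr rfl fun β hβ => ?_
        rw [hnhat ν hν β hβ]
      · intro β hβ β' hβ' h
        exact (hsplit ν hν β hβ ν hν β' hβ' h).2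
    · intro ν hν ν' hν' hne
      simp only [Function.onFun]
      rw [Finset.disjoint_left]
      intro γ hγ hγ'
      obtain ⟨β, hβ, rfl⟩ := Finset.mem_image.mp (Finset.mem_coe.mp hγ |> id)
      obtain ⟨β', hβ', h⟩ := Finset.mem_image.mp hγ'
      exact hne (hsplit ν hν β hβ ν' hν' β' hβ' h.symm).1
  exact exists_straightening_of_free B T hFhat hinjhat Rhat hRhatT nhat hnhatT ψ hψnhatT hS hX
    hstarhat

/-! ## §8 A worked instance -/

section Instance

/-- `K[X₀, X₁]`, tag variable `L = {1}`, sectors `ν ∈ {0, X₁}`: if `a₀ + a₁ · X₁ = 0` with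
`a₀, a₁` free of `X₁`, then `a₀ = a₁ = 0` — the sector expansion is unique. [folklore] -/
example {a₀ a₁ : MvPolynomial (Fin 2) K}
    (h₀ : ∀ d ∈ a₀.support, ∀ i ∈ d.support, i ∉ ({1} : Set (Fin 2)))
    (h₁ : ∀ d ∈ a₁.support, ∀ i ∈ d.support, i ∉ ({1} : Set (Fin 2)))
    (h : a₀ + a₁ * X 1 = 0) : a₀ = 0 ∧ a₁ = 0 := by
  classical
  have hne : (0 : Fin 2 →₀ ℕ) ≠ Finsupp.single 1 1 := by
    intro h0
    have := congrArg (fun f => f 1) h0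
    simp at this
  have hR : ∀ ν ∈ ({0, Finsupp.single 1 1} : Finset (Fin 2 →₀ ℕ)), ∀ i ∈ ν.support,
      i ∈ ({1} : Set (Fin 2)) := by
    intro ν hν i hi
    simp only [Finset.mem_insert, Finset.mem_singleton] at hν
    rcases hν with rfl | rfl
    · simp at hi
    · have hi1 : i = 1 := by
        by_contra hne1
        rw [Finsupp.mem_support_iff, Finsupp.single_apply, if_neg (Ne.symm hne1)] at hi
        exact hi rfl
      subst hi1
      rfl
  have ha : ∀ ν ∈ ({0, Finsupp.single 1 1} : Finset (Fin 2 →₀ ℕ)),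
      ∀ d ∈ ((fun μ : Fin 2 →₀ ℕ => if μ = 0 then a₀ else a₁) ν).support, ∀ i ∈ d.support,
        i ∉ ({1} : Set (Fin 2)) := by
    intro ν _ d hd i hi
    by_cases hν0 : ν = 0
    · simp only [hν0, if_true] at hd
      exact h₀ d hd i hi
    · simp only [hν0, if_false] at hd
      exact h₁ d hd i hi
  have hsum : ∑ ν ∈ ({0, Finsupp.single 1 1} : Finset (Fin 2 →₀ ℕ)),
      (fun μ : Fin 2 →₀ ℕ => if μ = 0 then a₀ else a₁) ν * monomial ν (1 : K) = 0 := by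
    rw [Finset.sum_pair hne]
    simp only [if_true, if_neg (Ne.symm hne)]
    rw [← C_apply, C_1, mul_one, ← h, X]
  have hz := eq_zero_of_sum_mul_monomial_eq_zero ({1} : Set (Fin 2)) _ hR ha hsum
  refine ⟨?_, ?_⟩
  · simpa using hz 0 (by simp)
  · simpa [if_neg (Ne.symm hne)] using hz (Finsupp.single 1 1) (by simp)

end Instance

end Literature.AlgebraicGeometry.Resolution.WeightedBlowup
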